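import Mathlib
import Literature.MathematicalPhysics.QuantumLattice.WilsonDiracAP
import Summits.QuantumFields.QCD.Theorems.QuarksAsStableActionCriticalLineDiamagnetismStubTilingCellData
import Summits.QuantumFields.QCD.Theorems.WilsonQuarkChessboardFlatCellOptimalStubCellGainOfGaugedAllN

/-!
# Cell data of the reflection tiling read on the `2⁴`-torus, `N` colours
(helper for crux stmt-QuantumFields-9307 `FlatCellOptimal`, line `registered`, stub
`stub_localNormGain_of` (G4 transport), sub-goal `stub_tilingCellDataAllN` — the `Fin 3 ↦ Fin N`
port of the sibling crux stmt-QuantumFields-9734's `…CriticalLineDiamagnetismStubTilingCellData`,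
wave 11)

What.  On the even torus `(ℤ/2M)⁴` let `tile_c V` be the period-2 reflection tiling of the `U(N)`
gauge field `V` (ANY `N : ℕ`) about the corner `c`, and let `W_c : Edge 4 2 → U(N)` be the tiling read
at the sixteen representatives `c + a`, `a ∈ {0,1}⁴` (lifted into `ℤ/2M` by `val`).  We prove the
finite bookkeeping behind the cell-gain assembly (`stub_tilingCellDataAllN`):
(i) every one of the `64` links `W_c (a, μ)` has the same `Re tr` as some CELL link of `V`
(a link `(x, μ)` with all offsets `val (x_ν - c_ν) ≤ 1` and `μ`-offset `0`);
(ii) `Σ_{(a, μ)} (N - Re tr W_c (a, μ)) ≤ 2 · Σ_{cell links e} (N - Re tr V e)`.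
The statement is the sibling's `stub_tilingCellData` with `Fin 3 ↦ Fin N`, `3 - Re tr ↦ N - Re tr`,
and with the two `let`s (`tile`, `Wc`) turned into universally quantified variables with their
defining equations (no `:=` in the registered signature).

How (the sibling's proof, `3 ↦ N`).  NORMAL FORM (`TilingCellData.link_eq`, any group):
`W_c (a, μ) = V (c + a, μ)` if `a_μ = 0` and `W_c (a, μ) = V (c + (a + e_μ), μ)⁻¹` if `a_μ = 1`
(offsets of `c + a` from `c` are the `val a_ν`; in the backward branch
`val ((y_μ + 1) - c_μ) mod 2 = (val (y_μ - c_μ) + 1) mod 2` because `2M` is even).  All further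
statements are phrased for a block field `W` in normal form.  Since `Re tr u⁻¹ = Re tr u` on `U(N)`
(`trace_re_inv`), the deficit of `W (a, μ)` is `F (a, μ) + F (a + e_μ, μ)` with
`F (a, μ) := [a_μ = 0] · (N - Re tr V (c + a, μ))`; `(a, μ) ↦ (a + e_μ, μ)` is an involution of
`Edge 4 2`, so the total is `2 Σ F`, and `Σ F ≤ Σ_cell` because `(a, μ) ↦ (c + a, μ)` is injective
and lands in the cell links when `a_μ = 0` (deficits are `≥ 0` on `U(N)`,
`…FlatCellOptimal.CellGain.CellGainOfGauged.deficit_nonneg`).  The `N`-free `ZMod` bookkeeping of the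
sibling file (`zmod_two_val_add_one`, `val_lt_two_mul`, `val_offset`, `site_then`, `site_else`,
`cell_link_mem`) is imported and re-EXPORTED into `…TilingData.TilingCellData` (aliases, no
restatement); the cell Finset enters the helper lemmas only through a membership hypothesis.
Sources: folklore lattice bookkeeping.  Pure theorem file (no `def`s).
-/

noncomputable section

open scoped BigOperators Classical Matrix ComplexConjugate
open Finset
open Literature.MathematicalPhysics.QuantumLattice Literature.MathematicalPhysics.QuantumFieldTheory
  Literature.Probability.LatticeModels

namespace Summit.QuantumFields.QCD.Cruxes.FlatCellOptimal.TilingData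

open Summit.QuantumFields.QCD.Cruxes.FlatCellOptimal.CellGain

namespace TilingCellData

/-! ### `N`-free bookkeeping of the sibling file, re-exported (aliases) -/

export Summit.QuantumFields.QCD.Cruxes.CriticalLineDiamagnetism.ChessboardCellGain.TilingCellData
  (zmod_two_val_add_one val_lt_two_mul val_offset site_then site_else cell_link_mem)

variable {N : ℕ}

/-! ### `Re tr` on `U(N)` -/

/-- `Re tr u⁻¹ = Re tr u` on `U(N)` (`u⁻¹ = u†`). -/
theorem trace_re_inv (u : Matrix.unitaryGroup (Fin N) ℂ) :
    (((u⁻¹ : Matrix.unitaryGroup (Fin N) ℂ) : Matrix (Fin N) (Fin N) ℂ)).trace.re =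
      ((u : Matrix (Fin N) (Fin N) ℂ)).trace.re := by
  -- adapted from `TilingCellData.trace_re_inv` (stmt-QuantumFields-9734; `3 ↦ N`, textual)
  rw [Matrix.UnitaryGroup.inv_val, Matrix.star_eq_conjTranspose, Matrix.trace_conjTranspose,
    Complex.star_def, Complex.conj_re]

variable {M : ℕ} [NeZero M]

/-! ### Normal form of the links of `W_c` (any group) -/

section NormalForm

variable {G : Type*} [Group G] (V : GaugeConfig 4 (2 * M) G) (c : Site 4 (2 * M))

/-- **Normal form.**  If `T` satisfies the defining equation of `tile_c V`, then its link read at the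
representative `c + a` in direction `μ` is `V (c + a, μ)` when `a_μ = 0` and `V (c + (a + e_μ), μ)⁻¹`
when `a_μ = 1` (any group `G`). -/
theorem link_eq {T : GaugeConfig 4 (2 * M) G}
    (hT : ∀ (x : Site 4 (2 * M)) (μ : Fin 4), T (x, μ) = if (x μ - c μ).val % 2 = 0
        then V (fun ν => c ν + (((x ν - c ν).val % 2 : ℕ) : ZMod (2 * M)), μ)
        else (V (fun ν => c ν + (((Site.shift x μ ν - c ν).val % 2 : ℕ) : ZMod (2 * M)), μ))⁻¹)
    (a : Fin 4 → ZMod 2) (μ : Fin 4) :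
    T (fun ν => c ν + (((a ν).val : ℕ) : ZMod (2 * M)), μ) =
      if a μ = 0 then V (fun ν => c ν + (((a ν).val : ℕ) : ZMod (2 * M)), μ)
      else (V (fun ν => c ν +
        ((((a + Pi.single μ 1 : Fin 4 → ZMod 2) ν).val : ℕ) : ZMod (2 * M)), μ))⁻¹ := by
  -- adapted from `TilingCellData.link_eq` (stmt-QuantumFields-9734; `U(3) ↦` any group)
  have hcond : ((c μ + (((a μ).val : ℕ) : ZMod (2 * M))) - c μ).val % 2 = 0 ↔ a μ = 0 := by
    rw [val_offset (c μ) (a μ), Nat.mod_eq_of_lt (ZMod.val_lt (a μ)), ZMod.val_eq_zero]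
  rw [hT]
  by_cases h : a μ = 0
  · rw [if_pos h]
    exact (if_pos (hcond.2 h)).trans (congrArg (fun s : Site 4 (2 * M) => V (s, μ)) (site_then c a))
  · rw [if_neg h]
    exact (if_neg (mt hcond.1 h)).trans
      (congrArg (fun s : Site 4 (2 * M) => (V (s, μ))⁻¹) (site_else c a μ))

/-- **Normal form of the cell field** `W_c e := tile c V (c + e.1, e.2)` of any `tile` satisfying the
items' defining equation (any group `G`). -/
theorem cellField_eq {tile : Site 4 (2 * M) → GaugeConfig 4 (2 * M) G → GaugeConfig 4 (2 * M) G}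
    (htile : ∀ (c : Site 4 (2 * M)) (V : GaugeConfig 4 (2 * M) G) (e : Edge 4 (2 * M)),
      tile c V e = if (e.1 e.2 - c e.2).val % 2 = 0
        then V (fun ν => c ν + (((e.1 ν - c ν).val % 2 : ℕ) : ZMod (2 * M)), e.2)
        else (V (fun ν => c ν + (((Site.shift e.1 e.2 ν - c ν).val % 2 : ℕ) : ZMod (2 * M)), e.2))⁻¹)
    {W : GaugeConfig 4 2 G}
    (hWc : ∀ e : Edge 4 2, W e = tile c V (fun ν => c ν + (((e.1 ν).val : ℕ) : ZMod (2 * M)), e.2))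
    (a : Fin 4 → ZMod 2) (μ : Fin 4) :
    W (a, μ) = if a μ = 0 then V (fun ν => c ν + (((a ν).val : ℕ) : ZMod (2 * M)), μ)
      else (V (fun ν => c ν +
        ((((a + Pi.single μ 1 : Fin 4 → ZMod 2) ν).val : ℕ) : ZMod (2 * M)), μ))⁻¹ :=
  (hWc (a, μ)).trans (link_eq V c (T := tile c V) (fun x μ => htile c V (x, μ)) a μ)

end NormalForm

variable (V : GaugeConfig 4 (2 * M) (Matrix.unitaryGroup (Fin N) ℂ)) (c : Site 4 (2 * M))
  {W : GaugeConfig 4 2 (Matrix.unitaryGroup (Fin N) ℂ)}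

omit [NeZero M] in
/-- **Deficit of a link of a block field in normal form** as `F (a, μ) + F (a + e_μ, μ)` with
`F (a, μ) := [a_μ = 0] · (N - Re tr V (c + a, μ))` (uses `Re tr u⁻¹ = Re tr u`). -/
theorem deficit_link_eq
    (hW : ∀ (a : Fin 4 → ZMod 2) (μ : Fin 4), W (a, μ) =
      if a μ = 0 then V (fun ν => c ν + (((a ν).val : ℕ) : ZMod (2 * M)), μ)
      else (V (fun ν => c ν +
        ((((a + Pi.single μ 1 : Fin 4 → ZMod 2) ν).val : ℕ) : ZMod (2 * M)), μ))⁻¹)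
    (a : Fin 4 → ZMod 2) (μ : Fin 4) :
    (N : ℝ) - ((W (a, μ) : Matrix.unitaryGroup (Fin N) ℂ) : Matrix (Fin N) (Fin N) ℂ).trace.re =
      (if a μ = 0 then (N : ℝ) - ((V (fun ν => c ν + (((a ν).val : ℕ) : ZMod (2 * M)), μ) :
          Matrix.unitaryGroup (Fin N) ℂ) : Matrix (Fin N) (Fin N) ℂ).trace.re else 0) +
      (if (a + Pi.single μ 1 : Fin 4 → ZMod 2) μ = 0 then (N : ℝ) - ((V (fun ν => c ν +
          ((((a + Pi.single μ 1 : Fin 4 → ZMod 2) ν).val : ℕ) : ZMod (2 * M)), μ) :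
          Matrix.unitaryGroup (Fin N) ℂ) : Matrix (Fin N) (Fin N) ℂ).trace.re else 0) := by
  -- adapted from `TilingCellData.deficit_link_eq` (stmt-QuantumFields-9734; `3 ↦ N`)
  have hflip : (a + Pi.single μ 1 : Fin 4 → ZMod 2) μ = a μ + 1 := by rw [Pi.add_apply, Pi.single_eq_same]
  rw [hW a μ, hflip]
  by_cases h : a μ = 0
  · rw [if_pos h, if_pos h, if_neg (by rw [h]; decide), add_zero]
  · rw [if_neg h, if_neg h, if_pos ((by decide : ∀ x : ZMod 2, x ≠ 0 → x + 1 = 0) _ h), zero_add,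
      trace_re_inv]

/-! ### Part (i): every link of `W_c` has the trace of a cell link -/

/-- **Part (i).**  Every link of a block field in normal form has the same `Re tr` as a cell link of
`V` (it is that link or its inverse). -/
theorem exists_cell_link
    (hW : ∀ (a : Fin 4 → ZMod 2) (μ : Fin 4), W (a, μ) =
      if a μ = 0 then V (fun ν => c ν + (((a ν).val : ℕ) : ZMod (2 * M)), μ)
      else (V (fun ν => c ν +
        ((((a + Pi.single μ 1 : Fin 4 → ZMod 2) ν).val : ℕ) : ZMod (2 * M)), μ))⁻¹)
    (e : Edge 4 2) :
    ∃ e' : Edge 4 (2 * M), ((∀ ν, (e'.1 ν - c ν).val ≤ 1) ∧ (e'.1 e'.2 - c e'.2).val = 0) ∧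
      ((W e : Matrix.unitaryGroup (Fin N) ℂ) : Matrix (Fin N) (Fin N) ℂ).trace.re =
        ((V e' : Matrix.unitaryGroup (Fin N) ℂ) : Matrix (Fin N) (Fin N) ℂ).trace.re := by
  -- adapted from `TilingCellData.exists_cell_link` (stmt-QuantumFields-9734; `3 ↦ N`)
  obtain ⟨a, μ⟩ := e
  rw [hW a μ]
  by_cases h : a μ = 0
  · rw [if_pos h]
    exact ⟨(fun ν => c ν + (((a ν).val : ℕ) : ZMod (2 * M)), μ), cell_link_mem c a μ h, rfl⟩
  · rw [if_neg h, trace_re_inv]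
    refine ⟨(fun ν => c ν +
        ((((a + Pi.single μ 1 : Fin 4 → ZMod 2) ν).val : ℕ) : ZMod (2 * M)), μ),
      cell_link_mem c (a + Pi.single μ 1 : Fin 4 → ZMod 2) μ ?_, rfl⟩
    rw [Pi.add_apply, Pi.single_eq_same]
    exact (by decide : ∀ x : ZMod 2, x ≠ 0 → x + 1 = 0) _ h

/-! ### Part (ii): the total deficit of `W_c` is at most twice the total cell deficit -/

/-- The forward halves inject into the cell links:
`Σ_{(a, μ) : a_μ = 0} (N - Re tr V (c + a, μ)) ≤ Σ_{cell links} (N - Re tr V)`. -/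
theorem sum_indicator_le {S : Finset (Edge 4 (2 * M))}
    (hS : ∀ e : Edge 4 (2 * M), ((∀ ν, (e.1 ν - c ν).val ≤ 1) ∧ (e.1 e.2 - c e.2).val = 0) → e ∈ S) :
    ∑ e : Edge 4 2, (if e.1 e.2 = 0 then (N : ℝ) - ((V (fun ν => c ν + (((e.1 ν).val : ℕ) : ZMod (2 * M)), e.2) :
        Matrix.unitaryGroup (Fin N) ℂ) : Matrix (Fin N) (Fin N) ℂ).trace.re else 0) ≤
      ∑ e ∈ S, ((N : ℝ) - ((V e : Matrix.unitaryGroup (Fin N) ℂ) : Matrix (Fin N) (Fin N) ℂ).trace.re) := by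
  -- adapted from `TilingCellData.sum_indicator_le` (stmt-QuantumFields-9734; `3 ↦ N`)
  have hinj : Set.InjOn
      (fun e : Edge 4 2 => ((fun ν => c ν + (((e.1 ν).val : ℕ) : ZMod (2 * M))), e.2))
      ↑(univ.filter fun e : Edge 4 2 => e.1 e.2 = 0) := by
    rintro ⟨a, μ⟩ - ⟨b, μ'⟩ - h
    simp only [Prod.mk.injEq] at h
    obtain ⟨hab, rfl⟩ := h
    rw [Prod.mk.injEq]
    refine ⟨funext fun κ => ?_, rfl⟩
    have hκ : c κ + (((a κ).val : ℕ) : ZMod (2 * M)) = c κ + (((b κ).val : ℕ) : ZMod (2 * M)) :=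
      congrFun hab κ
    have hv := congrArg ZMod.val (add_left_cancel hκ)
    rw [ZMod.val_cast_of_lt (val_lt_two_mul (a κ)), ZMod.val_cast_of_lt (val_lt_two_mul (b κ))] at hv
    exact ZMod.val_injective 2 hv
  have hmaps : ∀ e ∈ univ.filter (fun e : Edge 4 2 => e.1 e.2 = 0),
      ((fun ν => c ν + (((e.1 ν).val : ℕ) : ZMod (2 * M))), e.2) ∈ S :=
    fun e he => hS _ (cell_link_mem c e.1 e.2 (Finset.mem_filter.1 he).2)
  calc ∑ e : Edge 4 2, (if e.1 e.2 = 0 then (N : ℝ) - ((V (fun ν => c ν + (((e.1 ν).val : ℕ) : ZMod (2 * M)), e.2) :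
          Matrix.unitaryGroup (Fin N) ℂ) : Matrix (Fin N) (Fin N) ℂ).trace.re else 0)
      = ∑ e ∈ univ.filter (fun e : Edge 4 2 => e.1 e.2 = 0),
          ((N : ℝ) - ((V ((fun ν => c ν + (((e.1 ν).val : ℕ) : ZMod (2 * M))), e.2) :
            Matrix.unitaryGroup (Fin N) ℂ) : Matrix (Fin N) (Fin N) ℂ).trace.re) :=
        (Finset.sum_filter _ _).symm
    _ = ∑ e ∈ (univ.filter (fun e : Edge 4 2 => e.1 e.2 = 0)).image
          (fun e : Edge 4 2 => ((fun ν => c ν + (((e.1 ν).val : ℕ) : ZMod (2 * M))), e.2)),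
          ((N : ℝ) - ((V e : Matrix.unitaryGroup (Fin N) ℂ) : Matrix (Fin N) (Fin N) ℂ).trace.re) :=
        (Finset.sum_image (f := fun e : Edge 4 (2 * M) =>
          (N : ℝ) - ((V e : Matrix.unitaryGroup (Fin N) ℂ) : Matrix (Fin N) (Fin N) ℂ).trace.re) hinj).symm
    _ ≤ ∑ e ∈ S, ((N : ℝ) - ((V e : Matrix.unitaryGroup (Fin N) ℂ) : Matrix (Fin N) (Fin N) ℂ).trace.re) :=
        Finset.sum_le_sum_of_subset_of_nonneg (Finset.image_subset_iff.2 hmaps)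
          fun e _ _ => CellGainOfGauged.deficit_nonneg _

/-- **Part (ii).**  `Σ_{64 links} (N - Re tr W) ≤ 2 · Σ_{cell links} (N - Re tr V)` for a block field
`W` in normal form: the left-hand side is `Σ F + Σ F ∘ φ = 2 Σ F` for the involution
`φ (a, μ) = (a + e_μ, μ)` of `Edge 4 2`, and `Σ F ≤ Σ_cell` (`sum_indicator_le`). -/
theorem sum_deficit_le
    (hW : ∀ (a : Fin 4 → ZMod 2) (μ : Fin 4), W (a, μ) =
      if a μ = 0 then V (fun ν => c ν + (((a ν).val : ℕ) : ZMod (2 * M)), μ)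
      else (V (fun ν => c ν +
        ((((a + Pi.single μ 1 : Fin 4 → ZMod 2) ν).val : ℕ) : ZMod (2 * M)), μ))⁻¹)
    {S : Finset (Edge 4 (2 * M))}
    (hS : ∀ e : Edge 4 (2 * M), ((∀ ν, (e.1 ν - c ν).val ≤ 1) ∧ (e.1 e.2 - c e.2).val = 0) → e ∈ S) :
    ∑ e : Edge 4 2, ((N : ℝ) - ((W e : Matrix.unitaryGroup (Fin N) ℂ) : Matrix (Fin N) (Fin N) ℂ).trace.re) ≤
      2 * ∑ e ∈ S, ((N : ℝ) - ((V e : Matrix.unitaryGroup (Fin N) ℂ) : Matrix (Fin N) (Fin N) ℂ).trace.re) := by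
  -- adapted from `TilingCellData.sum_deficit_le` (stmt-QuantumFields-9734; `3 ↦ N`)
  have hφ : Function.Bijective (fun e : Edge 4 2 => ((e.1 + Pi.single e.2 1 : Fin 4 → ZMod 2), e.2)) :=
    Function.Involutive.bijective fun e => by
      show ((e.1 + Pi.single e.2 1 + Pi.single e.2 1 : Fin 4 → ZMod 2), e.2) = e
      rw [add_assoc, ← Pi.single_add, show (1 : ZMod 2) + 1 = 0 from by decide, Pi.single_zero,
        add_zero]
  calc ∑ e : Edge 4 2, ((N : ℝ) - ((W e : Matrix.unitaryGroup (Fin N) ℂ) : Matrix (Fin N) (Fin N) ℂ).trace.re)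
      = ∑ e : Edge 4 2,
          ((if e.1 e.2 = 0 then (N : ℝ) - ((V (fun ν => c ν + (((e.1 ν).val : ℕ) : ZMod (2 * M)), e.2) :
              Matrix.unitaryGroup (Fin N) ℂ) : Matrix (Fin N) (Fin N) ℂ).trace.re else 0) +
            (if (e.1 + Pi.single e.2 1 : Fin 4 → ZMod 2) e.2 = 0 then (N : ℝ) - ((V (fun ν => c ν +
              ((((e.1 + Pi.single e.2 1 : Fin 4 → ZMod 2) ν).val : ℕ) : ZMod (2 * M)), e.2) :
              Matrix.unitaryGroup (Fin N) ℂ) : Matrix (Fin N) (Fin N) ℂ).trace.re else 0)) :=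
        Finset.sum_congr rfl fun e _ => deficit_link_eq V c hW e.1 e.2
    _ = 2 * ∑ e : Edge 4 2, (if e.1 e.2 = 0 then (N : ℝ) - ((V (fun ν => c ν +
          (((e.1 ν).val : ℕ) : ZMod (2 * M)), e.2) :
          Matrix.unitaryGroup (Fin N) ℂ) : Matrix (Fin N) (Fin N) ℂ).trace.re else 0) := by
        rw [Finset.sum_add_distrib, (two_mul _ : (2 : ℝ) * _ = _)]
        congr 1
        exact Fintype.sum_bijective _ hφ _ _ fun _ => rfl
    _ ≤ 2 * ∑ e ∈ S, ((N : ℝ) - ((V e : Matrix.unitaryGroup (Fin N) ℂ) : Matrix (Fin N) (Fin N) ℂ).trace.re) :=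
        mul_le_mul_of_nonneg_left (sum_indicator_le V c hS) zero_le_two

end TilingCellData

/-- **Sub-goal `stub_tilingCellDataAllN` (G4 port, wave 11) — cell data of the tiling on the
`2⁴`-torus, `N` colours.**  For `tile` given by the items' defining equation and the cell field `Wc`
of the period-2 reflection tiling `tile c V` read at the representatives `c + a`, `a ∈ {0,1}⁴`, on the
even torus `(ℤ/2M)⁴`: (i) every one of its `64` links has the same `Re tr` as some cell link of `V`
(offsets `val (x_ν - c_ν) ≤ 1`, `μ`-offset `0`) — it is that link or its inverse; (ii) the total link
deficit `Σ (N - Re tr Wc)` is at most twice the total deficit of the `32` cell links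
(`TilingCellData.cellField_eq`, `TilingCellData.exists_cell_link`, `TilingCellData.sum_deficit_le`). -/
theorem stub_tilingCellDataAllN : ∀ (N M : ℕ) [NeZero M] (tile : Site 4 (2 * M) → GaugeConfig 4 (2 * M) (Matrix.unitaryGroup (Fin N) ℂ) → GaugeConfig 4 (2 * M) (Matrix.unitaryGroup (Fin N) ℂ)), (∀ (c : Site 4 (2 * M)) (V : GaugeConfig 4 (2 * M) (Matrix.unitaryGroup (Fin N) ℂ)) (e : Edge 4 (2 * M)), tile c V e = if (e.1 e.2 - c e.2).val % 2 = 0 then V (fun ν => c ν + (((e.1 ν - c ν).val % 2 : ℕ) : ZMod (2 * M)), e.2) else (V (fun ν => c ν + (((Site.shift e.1 e.2 ν - c ν).val % 2 : ℕ) : ZMod (2 * M)), e.2))⁻¹) → ∀ (V : GaugeConfig 4 (2 * M) (Matrix.unitaryGroup (Fin N) ℂ)) (c : Site 4 (2 * M)) (Wc : GaugeConfig 4 2 (Matrix.unitaryGroup (Fin N) ℂ)), (∀ e : Edge 4 2, Wc e = tile c V (fun ν => c ν + (((e.1 ν).val : ℕ) : ZMod (2 * M)), e.2)) → (∀ e :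 Edge 4 2, ∃ e' : Edge 4 (2 * M), ((∀ ν, (e'.1 ν - c ν).val ≤ 1) ∧ (e'.1 e'.2 - c e'.2).val = 0) ∧ ((Wc e : Matrix.unitaryGroup (Fin N) ℂ) : Matrix (Fin N) (Fin N) ℂ).trace.re = ((V e' : Matrix.unitaryGroup (Fin N) ℂ) : Matrix (Fin N) (Fin N) ℂ).trace.re) ∧ ∑ e : Edge 4 2, ((N : ℝ) - ((Wc e : Matrix.unitaryGroup (Fin N) ℂ) : Matrix (Fin N) (Fin N) ℂ).trace.re) ≤ 2 * ∑ e ∈ Finset.univ.filter (fun e : Edge 4 (2 * M) => (∀ ν, (e.1 ν - c ν).val ≤ 1) ∧ (e.1 e.2 - c e.2).val = 0), ((N : ℝ) - ((V e : Matrix.unitaryGroup (Fin N) ℂ) : Matrix (Fin N) (Fin N) ℂ).trace.re) := by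
  intro N M _ tile htile V c Wc hWc
  have hW := TilingCellData.cellField_eq V c htile hWc
  exact ⟨fun e => TilingCellData.exists_cell_link V c hW e,
    TilingCellData.sum_deficit_le V c hW fun e he => Finset.mem_filter.2 ⟨Finset.mem_univ _, he⟩⟩

end Summit.QuantumFields.QCD.Cruxes.FlatCellOptimal.TilingData

end
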